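import Summits.KontsevichZagierPeriods.KontsevichZagierPeriods.Theorems.LinRedNormalFormArrangementNormalFormStubRebaseSimplePosOnePosQuadChart

/-!
# Stub `stub_rebaseSimplePosOnePos` (crux `ArrangementNormalForm`, line `janus-bands`) —
part `QuadFarFrame`: the separation frame for the silent factors (`B = 2`)

`B = 2` corner calculus. To split the FAR silent factors `Lⱼ(x₁, x₂)` of a literal one-fibre
datum over the base `(x₁, x₂, y)` (base pole `y = 0`, letter `0`) by partial fractions in the
silent coordinate `x₂` (parts `SepPred*`), the datum is read in the SEPARATION FRAME
`(x₁, y, x₂; t)` — the coordinate swap `x₂ ↔ y` (`RebasePos.eQ`, a reindexing, rule 2) — as a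
representation of separation shape over the base `(x₁, y)` with distinguished coordinate `x₂`
(`SeparatePos.shape 2 1`): the silent factors depending on `x₂`, `Lⱼ = bⱼ (x₂ − λⱼ(x₁))`, are
the letters `λⱼ` (`RebasePos.sepLamQ`, multiplicities `sepDQ`), the factors in `x₁` alone and
the pole `y` are the silent factors (`sepLsQ`, `sepEsQ`), the constants `bⱼ^{−eⱼ}` go into the
numerator (`sepPQ = C (sepCQ) · p(X₀, X₂)`), the letter `1/t` is the fibre block, and rows and
bounds are re-indexed (`swapFQ`). The identification `RebasePos.shape_sepQ` is EXACT (with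
Lean's convention `1/0 = 0` on both sides).

References: M. Kontsevich, D. Zagier, *Periods* (2001), §1.2, rules (1b), (2).
-/

noncomputable section

open Set MeasureTheory MvPolynomial
open Literature.NumberTheory.Transcendental Literature.ModelTheory.ExponentialFields

namespace Summit.KontsevichZagierPeriods.ArrangementNormalForm.JanusBands

namespace RebasePos

open SeparatePos

section FarFrame

variable {m : ℕ}

/-- The separation frame: swap the slots of `x₂` and `y`. -/
def eQ : Fin (2 + 1 + 1) ≃ Fin (2 + 1 + 1) := Equiv.swap 1 2

/-- A full-base form read in the separation frame. -/
def swapFQ (c : (Fin (2 + 1) → ℚ) × ℚ) : (Fin (2 + 1) → ℚ) × ℚ := (![c.1 0, c.1 2, c.1 1], c.2)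

/-- Silent factors of the separation shape: the factors in `x₁` alone (exponent `eⱼ`; the
others get exponent `0`), then the pole `y`. -/
def sepLsQ (L : Fin m → (Fin 2 → ℚ) × ℚ) : Fin (m + 1) → (Fin 2 → ℚ) × ℚ :=
  Fin.snoc (fun j => (![(L j).1 0, 0], (L j).2)) (![0, 1], 0)

/-- Their exponents. -/
def sepEsQ (L : Fin m → (Fin 2 → ℚ) × ℚ) (e : Fin m → ℕ) : Fin (m + 1) → ℕ :=
  Fin.snoc (fun j => if (L j).1 1 = 0 then e j else 0) 1

/-- The `x₂`-letters `λⱼ(x₁) = −(aⱼ x₁ + cⱼ)/bⱼ` of the factors `Lⱼ = aⱼ x₁ + bⱼ x₂ + cⱼ`. -/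
def sepLamQ (L : Fin m → (Fin 2 → ℚ) × ℚ) : Fin m → (Fin 2 → ℚ) × ℚ :=
  fun j => (![-((L j).1 0 / (L j).1 1), 0], -((L j).2 / (L j).1 1))

/-- Their multiplicities (`0` for the factors in `x₁` alone). -/
def sepDQ (L : Fin m → (Fin 2 → ℚ) × ℚ) (e : Fin m → ℕ) : Fin m → ℕ :=
  fun j => if (L j).1 1 = 0 then 0 else e j

/-- The constant `∏ bⱼ^{−eⱼ}` over the factors depending on `x₂`. -/
def sepCQ (L : Fin m → (Fin 2 → ℚ) × ℚ) (e : Fin m → ℕ) : ℚ :=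
  ∏ j, if (L j).1 1 = 0 then 1 else ((L j).1 1)⁻¹ ^ e j

/-- The numerator of the separation shape: `∏ bⱼ^{−eⱼ} · p(X₀, X₂)`. -/
def sepPQ (L : Fin m → (Fin 2 → ℚ) × ℚ) (e : Fin m → ℕ) (p : MvPolynomial (Fin 2) ℚ) : MvPolynomial (Fin (2 + 1)) ℚ :=
  MvPolynomial.C (sepCQ L e) * MvPolynomial.rename (![0, 2] : Fin 2 → Fin (2 + 1)) p

/-- `eQ` on the `x₁`-slot. -/
@[simp] theorem eQ_zero : eQ 0 = 0 := by rw [eQ, Equiv.swap_apply_of_ne_of_ne (by decide) (by decide)]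

/-- `eQ` on the second slot. -/
@[simp] theorem eQ_one : eQ 1 = 2 := by rw [eQ, Equiv.swap_apply_left]

/-- `eQ` on the third slot. -/
@[simp] theorem eQ_two : eQ 2 = 1 := by rw [eQ, Equiv.swap_apply_right]

/-- `eQ` on the `t`-slot. -/
@[simp] theorem eQ_three : eQ 3 = 3 := by rw [eQ, Equiv.swap_apply_of_ne_of_ne (by decide) (by decide)]

/-- `eQ` is an involution on points. -/
theorem eQ_eQ (w : Fin (2 + 1 + 1) → ℝ) : (fun i => (fun j => w (eQ j)) (eQ i)) = w := by
  funext i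
  show w (eQ (eQ i)) = w i
  rw [eQ, Equiv.swap_apply_self]

/-- Full-base forms in the separation frame. -/
theorem affF_swapFQ (c : (Fin (2 + 1) → ℚ) × ℚ) (w : Fin (2 + 1 + 1) → ℝ) :
    affF 2 1 (swapFQ c) w = affF 2 1 c (fun i => w (eQ i)) := by
  rw [affF_three, affF_three, swapFQ]
  simp
  ring

/-- Silent (`x'`-)forms of the original frame, in the separation frame: `a x₁ + b x₂ + c` with
`(x₁, x₂) = (w₀, w₂)`. -/
theorem affB_eQ (d : (Fin 2 → ℚ) × ℚ) (w : Fin (2 + 1 + 1) → ℝ) :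
    affB 2 1 d (fun i => w (eQ i)) = (d.1 0 : ℝ) * w 0 + (d.1 1 : ℝ) * w 2 + (d.2 : ℝ) := by
  rw [affB_three]
  simp

/-- A factor depending on `x₂`, as a letter: `L = b (x₂ − λ)`. -/
theorem affB_eQ_letter (d : (Fin 2 → ℚ) × ℚ) (hd : d.1 1 ≠ 0) (w : Fin (2 + 1 + 1) → ℝ) :
    affB 2 1 d (fun i => w (eQ i)) = (d.1 1 : ℝ) * (w 2 - affB 2 1 (![-(d.1 0 / d.1 1), 0], -(d.2 / d.1 1)) w) := by
  have hd' : (d.1 1 : ℝ) ≠ 0 := by exact_mod_cast hd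
  rw [affB_eQ, affB_three]
  simp only [Matrix.cons_val_zero, Matrix.cons_val_one, Rat.cast_neg, Rat.cast_div, Rat.cast_zero, zero_mul, add_zero]
  field_simp
  ring

/-- A factor in `x₁` alone, as a silent factor of the separation frame. -/
theorem affB_eQ_silent (d : (Fin 2 → ℚ) × ℚ) (hd : d.1 1 = 0) (w : Fin (2 + 1 + 1) → ℝ) :
    affB 2 1 d (fun i => w (eQ i)) = affB 2 1 (![d.1 0, 0], d.2) w := by
  rw [affB_eQ, affB_three, hd]
  simp

/-- One factor of the separation shape: `Lⱼ^{eⱼ} = (silent)^{es} · (constant)⁻¹ · (x₂ − λⱼ)^{dⱼ}`. -/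
theorem pow_affB_eQ (L : Fin m → (Fin 2 → ℚ) × ℚ) (e : Fin m → ℕ) (j : Fin m) (w : Fin (2 + 1 + 1) → ℝ) :
    affB 2 1 (L j) (fun i => w (eQ i)) ^ e j =
      affB 2 1 (![(L j).1 0, 0], (L j).2) w ^ (if (L j).1 1 = 0 then e j else 0) *
        (((if (L j).1 1 = 0 then 1 else ((L j).1 1)⁻¹ ^ e j : ℚ) : ℝ))⁻¹ *
        (w 2 - affB 2 1 (sepLamQ L j) w) ^ (if (L j).1 1 = 0 then 0 else e j) := by
  by_cases h : (L j).1 1 = 0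
  · rw [if_pos h, if_pos h, if_pos h, affB_eQ_silent _ h]
    simp
  · rw [if_neg h, if_neg h, if_neg h, affB_eQ_letter _ h, sepLamQ, mul_pow]
    have hb : ((L j).1 1 : ℝ) ≠ 0 := by exact_mod_cast h
    push_cast
    rw [inv_pow, inv_inv, pow_zero, one_mul]

/-- The product of the silent factors of the original frame, in the separation frame. -/
theorem prod_pow_affB_eQ (L : Fin m → (Fin 2 → ℚ) × ℚ) (e : Fin m → ℕ) (w : Fin (2 + 1 + 1) → ℝ) :
    ∏ j, affB 2 1 (L j) (fun i => w (eQ i)) ^ e j =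
      (∏ j : Fin m, affB 2 1 (sepLsQ L (Fin.castSucc j)) w ^ sepEsQ L e (Fin.castSucc j)) *
        ((sepCQ L e : ℚ) : ℝ)⁻¹ * ∏ j, (w 2 - affB 2 1 (sepLamQ L j) w) ^ sepDQ L e j := by
  simp only [pow_affB_eQ, Finset.prod_mul_distrib, sepLsQ, sepEsQ, sepDQ, sepCQ, Fin.snoc_castSucc,
    Finset.prod_inv_distrib, Rat.cast_prod]

/-- The numerator in the separation frame. -/
theorem aeval_sepPQ (L : Fin m → (Fin 2 → ℚ) × ℚ) (e : Fin m → ℕ) (p : MvPolynomial (Fin 2) ℚ)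
    (w : Fin (2 + 1 + 1) → ℝ) :
    MvPolynomial.aeval (fun i : Fin (2 + 1) => w (Fin.castAdd 1 i)) (sepPQ L e p) =
      ((sepCQ L e : ℚ) : ℝ) * MvPolynomial.aeval (fun i : Fin 2 => (fun j => w (eQ j)) (Fin.castSucc (Fin.castSucc i))) p := by
  have harg : (fun i : Fin 2 => (fun j => w (eQ j)) (Fin.castSucc (Fin.castSucc i))) =
      (fun i : Fin (2 + 1) => w (Fin.castAdd 1 i)) ∘ (![0, 2] : Fin 2 → Fin (2 + 1)) := by
    funext i
    fin_cases i
    · show w (eQ 0) = w 0; rw [eQ_zero]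
    · show w (eQ 1) = w 2; rw [eQ_one]
  rw [sepPQ, map_mul, MvPolynomial.aeval_C, MvPolynomial.aeval_rename, eq_ratCast, harg]

/-- **The separation shape is the literal integrand read in the separation frame.** -/
theorem shape_sepQ (L : Fin m → (Fin 2 → ℚ) × ℚ) (e : Fin m → ℕ) (p : MvPolynomial (Fin 2) ℚ)
    (ℓ₁ : (Fin 2 → ℚ) × ℚ) (w : Fin (2 + 1 + 1) → ℝ) :
    shape 2 1 (sepPQ L e p) (sepLsQ L) (sepEsQ L e) (sepLamQ L) (sepDQ L e) (fun _ => some 0) w =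
      glit 2 1 p L e ℓ₁ 0 0 1 (fun _ => some 0) (fun i => w (eQ i)) := by
  have hpole : affB 2 1 (![0, 1], 0) w = w 1 := by rw [affB_three]; simp
  have h0 : affB 2 1 (0 : (Fin 2 → ℚ) × ℚ) (fun i => w (eQ i)) = 0 := by simp [affB_three]
  have hfib : fib 2 1 (fun _ : Fin 1 => some (0 : (Fin (2 + 1) → ℚ) × ℚ)) w = 1 / w 3 := by
    simp [fib]
  rw [glit_three, prod_pow_affB_eQ, shape, aeval_sepPQ, Fin.prod_univ_castSucc, hfib, h0, sub_zero]
  simp only [sepLsQ, sepEsQ, Fin.snoc_last, Fin.snoc_castSucc, pow_one, hpole, Finset.prod_inv_distrib, mul_inv, inv_inv,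
    div_eq_mul_inv]
  rw [show (Fin.castAdd 1 (Fin.last 2) : Fin (2 + 1 + 1)) = 2 from rfl, eQ_two, eQ_three]
  ring

/-- Membership in the literal domain, read in the separation frame. -/
theorem mem_gDom_swapFQ {m' : ℕ} (M : Fin m' → (Fin (2 + 1) → ℚ) × ℚ) (u v : (Fin (2 + 1) → ℚ) × ℚ)
    (w : Fin (2 + 1 + 1) → ℝ) :
    w ∈ gDom 2 1 m' (fun j => swapFQ (M j)) (fun _ => Sum.inr (swapFQ u)) (fun _ => Sum.inr (swapFQ v)) ↔
      (fun i => w (eQ i)) ∈ gDom 2 1 m' M (fun _ => Sum.inr u) (fun _ => Sum.inr v) := by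
  rw [mem_gDom_one, mem_gDom_one, jt_eq, eQ_three]
  simp only [affF_swapFQ]

end FarFrame

end RebasePos

/-- **Registered part of `stub_rebaseSimplePosOnePos` (line `janus-bands`, `B = 2` corner
calculus): the separation shape is the literal integrand read in the separation frame.** After
the coordinate swap `x₂ ↔ y` (`RebasePos.eQ`), the literal one-fibre integrand
`p(x')/∏ Lⱼ(x')^{eⱼ} · 1/y · 1/t` over the base `(x₁, x₂, y)` is EXACTLY the separation shape
over the base `(x₁, y)` with distinguished coordinate `x₂`: letters `λⱼ(x₁)` of the factors
depending on `x₂`, silent factors in `x₁` alone and the pole `y`, numerator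
`∏ bⱼ^{−eⱼ} p(X₀, X₂)`, fibre block `1/t` (`RebasePos.shape_sepQ`). -/
theorem rebaseSimplePos_shapeSepQ (m : ℕ) (L : Fin m → (Fin 2 → ℚ) × ℚ) (e : Fin m → ℕ) (p : MvPolynomial (Fin 2) ℚ) (ℓ₁ : (Fin 2 → ℚ) × ℚ) (w : Fin (2 + 1 + 1) → ℝ) : SeparatePos.shape 2 1 (RebasePos.sepPQ L e p) (RebasePos.sepLsQ L) (RebasePos.sepEsQ L e) (RebasePos.sepLamQ L) (RebasePos.sepDQ L e) (fun _ => some 0) w = RebasePos.glit 2 1 p L e ℓ₁ 0 0 1 (fun _ => some 0) (fun i => w (RebasePos.eQ i)) :=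
  RebasePos.shape_sepQ L e p ℓ₁ w

end Summit.KontsevichZagierPeriods.ArrangementNormalForm.JanusBands
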